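import Summits.Ventures.YMGap.YM4Door.HaarForm
import Summits.Ventures.YMGap.Thresholds.DSWindowCertificate

/-!
# YM4Door / OpenDoor — THE OPEN DOOR: β-uniformity of the block-level IR leg = U-CV (exit actions Cauchy in LOAD currency)
# + a receiver that is an open set; the β-free K-step CROSSOVER OPERATOR; the volume-uniform (D-0037) form

HONEST FRAMING (cell `ym-beyond`, seat P2 «strong-coupling bridge», HUMAN RULING D-0035 / D-0037; tree edition, g8,
2026-08-25, of the farm-checked HOME sketches `HOME/ROUTE-P2-SketchOpen.lean` v0.6 sha16 44ea1120d7666484 §9 and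
`HOME/ROUTE-P2-SketchCrossover.lean` v0.7 sha16 c898b49a904022c7 §1–§4 — namespaces `YMBeyond.P2.Strip` /
`YMBeyond.P2.Crossover` → `Summit.Ventures.YMGap.YM4Door`; memo `HOME/ROUTE-P2.md` §2.7, §4e–§4f; referee baseline v0.7 PASS).
LATTICE / finite-torus bookkeeping only: nothing here is a continuum, spectral or Clay-sense statement; nothing here
moves the weak-coupling exit of Track A (uncertified); nothing here is a part of Bałaban's theorems; NO member of any
door, NO Dobrushin–Shlosman window certificate and NO instance of the two named inputs N-CVg / N-NP below is asserted to
exist (the window door is typed over the tree's `Summit.Ventures.YMGap.DSWindow.Certificate` with its two inputs GAP-STATED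
as named `Prop`s).  Every non-trivial analytic step is a TREE theorem used BY NAME (`RobustBall/BallClosureTorus.lean`
`inBall_add`; `Thresholds/DSWindowCertificate.lean`; `Literature/…/BlockScaleEffectivePerturbation.lean`
`GaugeBlockAveraging`, `IsBlockingOf`, `IsBalabanEffectiveActionOf`; this directory's `StripDoor.lean`).  This file
contains NO conjecture name, NO `sorry`, NO axiom beyond the standard three.  Label K = kernel bookkeeping throughout.

* §1 THE OPEN DOOR.  Every receiver in hand is an OPEN SET in load currency, hence β-UNIFORMITY of the IR leg is not a
  property of the door: it is U-CV, «the unit-block-scale exit actions at the various bare couplings / depths are CLOSE, in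
  the receiver's norm, to one reference action in the door's core» (`CloseInLoads`; in Bałaban's strip currency
  `CloseInStrip ⇒ CloseInLoads`).  ★ `OpenDoor.clustersWith_forall` / `OpenDoor.blockClusters_forall`: open door ∧
  reference in the core ∧ U-CV ⇒ block-level IR for EVERY index with the SAME constants.  Instances: every Dobrushin cell
  (`OpenDoor.ofDoorCell`; the coupling drifts freely inside the cell), the Haar basin (`OpenDoor.ofBasin`; coupling drift
  priced `72√2 e^κ` per unit), and the Dobrushin–Shlosman WINDOW door `OpenDoor.DSDoor S R N⋆ γ` over the tree's certificate
  structure with its two inputs GAP-STATED (`DSDoorClusters`: certificate ⇒ clustering in the ball's currency; `DSDoorOpen`: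
  certificates are open in load currency) — `OpenDoor.ofDS`; SANITY `mem_DSDoor_of_isKRContraction` (the window door
  contains the single-link Dobrushin door, tree `Certificate.ofKRContraction`).  Corollaries `blockClusters_forall_third(_strip)`.
* §2 CAUCHY IN LOADS ⇒ CLOSE IN LOADS.  Consecutive exit actions (index = depth `K`) differing by coupling drift `≤ σc K`
  and a perturbation of loads `≤ (σ₀ K, σ₁ K)` are, from any depth `K₀` on, `CloseInLoads` about the exit action AT DEPTH
  `K₀` with tolerances the partial sums (`closeInLoads_of_cauchyInLoads`); geometric majorants `C θ^K` give the tails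
  `C θ^{K₀}/(1−θ)` (`closeInLoads_of_cauchyInLoads_geometric`) and the depth threshold `K₀ ≥ log(C/(τ(1−θ)))/log(1/θ)`
  (`geometric_tail_le`) — the typed home of the crossover NUMBER on the convergence axis; ★ `blockClusters_from_depth`.
* §3 THE CROSSOVER OPERATOR.  As `β → ∞` all but a β-FREE number `K` of renormalisation steps run at small running
  coupling (memo §2.7), so H-a factorises into (N-CVg) convergence of the scale-`g` effective actions in Track A's OWN
  currency — `NearInStrip` on the scale-`g` torus `bK·S` — and (N-NP) continuity AT ONE POINT of the `K`-step map from strip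
  currency to LOAD currency — `CrossoverContinuousAt`, EXISTENTIAL in the exit representation (polymer representations are
  not unique) and tied to the renormalisation group by `IsCrossoverImage BK x y := BK.IsBlockingOf (e^{−x}) (e^{−y})`.
  Proved glue: `blockIRVia_comp` (scale-`g` Gibbs form ∧ crossover image ⇒ Gibbs form under the COMPOSITE blocking),
  `SU2.blockClusters_iff_via`, ★ `blockIR_forall_of_crossover`.
* §4 VOLUME-UNIFORM FORM (D-0037: a per-torus clustering statement is vacuous).  ★ `blockIR_uniform_of_crossover`: the
  same with `∀ S ≥ 3` INSIDE and every tolerance / constant `S`-free.  §5 `SU(2)` instances on the certified `1/3` cell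
  (`blockIR_uniform_third`, `blockIR_uniform_third_wilson`).

NOT HERE: which blocking carries N-NP and the Haar-exactness of axial decimation (HOME `ROUTE-P2-SketchDecimation.lean`,
g8, not lifted); observable transport (`YM4Door/BlockTransport.lean`); the Haar form (`YM4Door/HaarForm.lean`).  Where THE
NUMBER moves (memo §2.6–§2.7): to the window-size axis of the certificate of ONE reference blocked action, to the tolerance
of U-CV against that certificate's openness margin, and to the β-free depth `K(γ₀) ≈ 3.88·(4/γ₀ − 2.3) + K_door`.

References: T. Bałaban, CMP 119 (1988) p. 243 (0.1), p. 258 (2.23), p. 259 (ii),(iv), p. 261 (2.42), p. 262 Thm 1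
[Balaban1988Convergent]; CMP 122 (1989) 175–202, 355–392 [Balaban1989LargeFieldII]; R. L. Dobrushin, S. B. Shlosman, in:
Statistical Physics and Dynamical Systems (1985) 347–370 and J. Stat. Phys. 46 (1987) 983–1014; F. Martinelli,
E. Olivieri, CMP 161 (1994) 447–486; L. Gross, CMP 92 (1983) 137–162 and B. K. Driver, CMP 110 (1987) 479–501 (the only
convergence-of-effective-action theorems in print, U(1)); A. C. D. van Enter, R. Fernández, A. D. Sokal, J. Stat. Phys. 72
(1993) 879–1167 (non-Gibbsianness of renormalised measures — the honest threat to N-NP); the tree files named above.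

THIS MODULE: §0–§1 (the open door, its instances cell / basin / Dobrushin–Shlosman window door, the uniformity theorem); §2–§5
(Cauchy in loads, the crossover operator and N-NP, the volume-uniform form, the `1/3`-cell instances) are `YM4Door/Crossover.lean` (one text, g8).
-/

noncomputable section

open MeasureTheory Finset Function Metric
open scoped Matrix.Norms.Frobenius
open Literature.Probability.LatticeModels Literature.Probability.LatticeModels.DobrushinMetric
open Literature.MathematicalPhysics.QuantumLattice hiding torusNorm configShift
open Literature.MathematicalPhysics.QuantumFieldTheory hiding ZdEdge
open Summit.Ventures.YMGap.RobustBall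
open Summit.Ventures.YMGap.StarResolventDim (Delta gaugeR doorPoly)
open Summit.Ventures.YMGap.YM3IR.ReceiverWitness

namespace Summit.Ventures.YMGap.YM4Door

variable {d L N : ℕ} [NeZero L]

/-! ## §0  One helper -/

/-- `InBall κ` is monotone in its two radii (one line; the tree's `clusterDomain_mono`, radii part). -/
theorem inBall_mono {κ a b a' b' : ℝ} {W : Perturbation d L N} (h : InBall κ a b W) (ha : a ≤ a') (hb : b ≤ b') :
    InBall κ a' b' W := by
  obtain ⟨w, h₀, h₁⟩ := h
  exact ⟨w, fun e => (h₀ e).trans ha, fun e => (h₁ e).trans hb⟩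

/-! ## §1  THE OPEN DOOR: β-uniformity of the IR leg = U-CV (exit actions Cauchy in LOAD currency) + a receiver that
is an OPEN SET in load currency

Doors are open sets.  Every receiver in hand — the Dobrushin cells, the Haar basin — and the one receiver that could sit at
larger effective coupling — a Dobrushin–Shlosman finite-WINDOW (strong-mixing) certificate, the tree's
`Summit.Ventures.YMGap.DSWindow.Certificate`, an open condition on the interaction AT EVERY COUPLING rather than a
high-temperature one — is stable under adding a perturbation of small LOADS (tree `inBall_add`) and under a small drift of
the effective coupling.  Consequently UNIFORMITY IN THE BARE COUPLING of the IR leg is not a property of the door at all: it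
is the statement that the renormalisation-group trajectory's ENDPOINTS (the unit-block-scale exit actions at the various
bare couplings, i.e. depths) form a family CLOSE, in the receiver's norm, to one reference endpoint sitting in the door's
core — U-CV (`CloseInLoads`; in Bałaban's strip currency `CloseInStrip`).  For an explicitly described door (a cell) U-CV is
redundant (membership index by index is uniformity: §5); for a door known only through ONE certified reference action plus
an openness margin — the window-certificate case, where a certificate is a finite computation about one action — U-CV with
tolerance below the margin IS the uniformity.  This is where the crossover NUMBER moves (memo §2.6): to the window size of
the certificate of the reference blocked action, and to U-CV's tolerance against that certificate's margin. -/

/-- **An OPEN DOOR at block-torus size `S`** with clustering constants `(A, m)`, open IN LOAD CURRENCY with margins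
`(τc; τ₀, τ₁)` at rate `κ` around a core: a set `door` of (tree coupling, perturbation) pairs each of which clusters at
`(A, m)`, and a set `core` such that moving the coupling of a core member by `≤ τc` and adding to it any perturbation of
loads `≤ (τ₀, τ₁)` lands in `door`.  A `structure` carrying data and proofs; instances below (`ofDoorCell`, `ofBasin`,
`ofDS`); nothing asserts that a given pair belongs to any door. -/
structure OpenDoor (S : ℕ) [NeZero S] (A m κ τc τ₀ τ₁ : ℝ) where
  /-- the door: (tree coupling, perturbation) pairs -/
  door : Set (ℝ × Perturbation 4 S 2)
  /-- the core: members with margin `(τc; τ₀, τ₁)` to spare -/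
  core : Set (ℝ × Perturbation 4 S 2)
  /-- every door member clusters at `(A, m)` -/
  clusters : ∀ (β : ℝ) (W : Perturbation 4 S 2), (β, W) ∈ door → ClustersWith W β A m
  /-- openness in load currency -/
  isOpen : ∀ (β : ℝ) (W : Perturbation 4 S 2), (β, W) ∈ core → ∀ (c : ℝ) (V : Perturbation 4 S 2), |c| ≤ τc →
    InBall κ τ₀ τ₁ V → (β + c, W + V) ∈ door

/-- ★ **U-CV, typed — THE EXIT ACTIONS ARE CLOSE IN LOAD CURRENCY.**  A family `𝓔 i` (`i`: bare coupling / depth) of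
unit-block-scale effective actions on the block torus `S` is `(τc; κ, τ₀, τ₁)`-close to the reference `(βr, Wr)`: every
effective coupling is within `τc` of `βr` and every term family is `Wr` plus a perturbation of loads `≤ (τ₀, τ₁)` at rate
`κ`.  What the d = 4 programme would have to deliver at its last scale UNIFORMLY in the bare coupling — closeness of the
trajectory's endpoints in the receiver's norm (ultraviolet stability is a BOUND on each endpoint; this is a statement about
their DIFFERENCES, of the kind of — and weaker than — convergence of effective actions as the cutoff is removed). -/
@[folklore] def CloseInLoads {S : ℕ} [NeZero S] {ι : Type*} (𝓔 : ι → BalabanEffectiveAction 4 S (SUN 2) 1) (βr : ℝ)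
    (Wr : Perturbation 4 S 2) (τc κ τ₀ τ₁ : ℝ) : Prop :=
  ∀ i, |(𝓔 i).β - βr| ≤ τc ∧ ∃ V : Perturbation 4 S 2, (𝓔 i).terms = Wr + V ∧ InBall κ τ₀ τ₁ V

/-- **U-CV in Bałaban's currency**: the differences `terms_i − Wr` are in strip format `(r, κ, τ)` — (2.42)-norm `≤ τ` on
the strip of width `r` at rate `κ` — with thin supports. -/
@[folklore] def CloseInStrip {S : ℕ} [NeZero S] {ι : Type*} (𝓔 : ι → BalabanEffectiveAction 4 S (SUN 2) 1) (βr : ℝ)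
    (Wr : Perturbation 4 S 2) (τc r κ τ : ℝ) : Prop :=
  ∀ i, |(𝓔 i).β - βr| ≤ τc ∧ ∃ V : Perturbation 4 S 2, (𝓔 i).terms = Wr + V ∧
    V.HasAnalyticNormLE SU2.ρ2 (fun _ => stripDomain SU2.ρ2 r) κ τ ∧ ∀ X, V.act X ≠ 0 → (polymerDiam X : ℝ) ≤ (X.card : ℝ) - 1

/-- Strip closeness ⇒ load closeness with tolerances `(2τ, 8τ/(eδr))` at any rate `κ_b ∈ [0, κ − δ]`, `δ > 0` (§3). -/
theorem closeInLoads_of_closeInStrip {S : ℕ} [NeZero S] {ι : Type*} {𝓔 : ι → BalabanEffectiveAction 4 S (SUN 2) 1}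
    {βr : ℝ} {Wr : Perturbation 4 S 2} {τc r κ τ κb δ : ℝ} (h : CloseInStrip 𝓔 βr Wr τc r κ τ) (hr : 0 < r)
    (hκb : 0 ≤ κb) (hδ : 0 < δ) (hκ : κb + δ ≤ κ) :
    CloseInLoads 𝓔 βr Wr τc κb (2 * τ) (8 / (Real.exp 1 * δ * r) * τ) := by
  intro i
  obtain ⟨hc, V, hV, hA, hsupp⟩ := h i
  refine ⟨hc, V, hV, ?_⟩
  have hmem : InBall κb (2 * τ) (2 * ((4 : ℕ) : ℝ) / (Real.exp 1 * δ * r) * τ) V :=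
    mem_clusterDomain_of_hasAnalyticNormLE_strip V hr hA hsupp hκb hδ hκ
  have e : (2 : ℝ) * ((4 : ℕ) : ℝ) = 8 := by norm_num
  rw [e] at hmem
  exact hmem

namespace OpenDoor

/-- ★ **UNIFORMITY FROM AN OPEN DOOR.**  Reference in the core ∧ U-CV closeness within the margins ⇒ EVERY member of the
family clusters at the door's constants `(A, m)` — the same for all `i`. -/
theorem clustersWith_forall {S : ℕ} [NeZero S] {A m κ τc τ₀ τ₁ : ℝ} (D : OpenDoor S A m κ τc τ₀ τ₁) {ι : Type*}
    {𝓔 : ι → BalabanEffectiveAction 4 S (SUN 2) 1} {βr : ℝ} {Wr : Perturbation 4 S 2} (href : (βr, Wr) ∈ D.core)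
    (hcv : CloseInLoads 𝓔 βr Wr τc κ τ₀ τ₁) (i : ι) : ClustersWith (𝓔 i).terms (𝓔 i).β A m := by
  obtain ⟨hc, V, hV, hVB⟩ := hcv i
  have hmem := D.isOpen βr Wr href ((𝓔 i).β - βr) V hc hVB
  have h := D.clusters _ _ hmem
  have e : βr + ((𝓔 i).β - βr) = (𝓔 i).β := by ring
  rw [e, ← hV] at h
  exact h

/-- ★ **β-UNIFORM BLOCK-LEVEL IR FROM U-CV AND AN OPEN DOOR.**  Blockings `B i` (their depth may vary with `i`) onto the
SAME block torus `S`, bare couplings `βbare i`, exit actions `𝓔 i` in Gibbs form; an open door; a reference in its core;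
U-CV ⇒ `BlockClusters (B i) (βbare i) A m` for EVERY `i`, with the door's constants. -/
theorem blockClusters_forall {S : ℕ} [NeZero S] {A m κ τc τ₀ τ₁ : ℝ} (D : OpenDoor S A m κ τc τ₀ τ₁) {ι : Type*}
    {bOf : ι → ℕ} [∀ i, NeZero (bOf i)] (B : ∀ i, GaugeBlockAveraging 4 (SUN 2) (bOf i) S) (βbare : ι → ℝ)
    (𝓔 : ι → BalabanEffectiveAction 4 S (SUN 2) 1) (hGibbs : ∀ i, IsBalabanEffectiveActionOf SU2.ρ2 (B i) (βbare i) (𝓔 i))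
    {βr : ℝ} {Wr : Perturbation 4 S 2} (href : (βr, Wr) ∈ D.core) (hcv : CloseInLoads 𝓔 βr Wr τc κ τ₀ τ₁) (i : ι) :
    SU2.BlockClusters (B i) (βbare i) A m :=
  ⟨𝓔 i, hGibbs i, D.clustersWith_forall href hcv i⟩

/-- **Every certified Dobrushin cell is an open door** (margins subtracted from its radii; the coupling drifts FOR FREE
inside `[τc, β₀ − τc]`): door `= [0, β₀] × InBall κ ε₀ ε₁`, core `= [τc, β₀ − τc] × InBall κ (ε₀ − τ₀) (ε₁ − τ₁)`; openness
is the tree's additivity of loads `inBall_add`. -/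
def ofDoorCell {S : ℕ} [NeZero S] {β₀ ε₀ ε₁ : ℝ} (hcell : DoorCell β₀ ε₀ ε₁) (hS : 3 ≤ S) {κ : ℝ} (hκ : 1 / 100 ≤ κ)
    (τc τ₀ τ₁ : ℝ) : OpenDoor S (16 * Real.exp (1 / 50)) (1 / 100) κ τc τ₀ τ₁ where
  door := {p | 0 ≤ p.1 ∧ p.1 ≤ β₀ ∧ InBall κ ε₀ ε₁ p.2}
  core := {p | τc ≤ p.1 ∧ p.1 ≤ β₀ - τc ∧ InBall κ (ε₀ - τ₀) (ε₁ - τ₁) p.2}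
  clusters β W hp := by
    obtain ⟨h0, h1, hW⟩ := hp
    exact hcell κ hκ β h0 h1 S hS W hW
  isOpen β W hp c V hc hV := by
    obtain ⟨h0, h1, hW⟩ := hp
    have hc' := abs_le.1 hc
    show 0 ≤ β + c ∧ β + c ≤ β₀ ∧ InBall κ ε₀ ε₁ (W + V)
    refine ⟨?_, ?_, ?_⟩
    · change τc ≤ β at h0
      linarith [hc'.1]
    · change β ≤ β₀ - τc at h1
      linarith [hc'.2]
    · have h := inBall_add hW hV
      rwa [sub_add_cancel, sub_add_cancel] at h

/-- **The Haar basin is an open door** with the coupling drift PRICED by the certified Wilson loads (`72√2 e^κ` of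
Lipschitz budget per unit of tree coupling, §8): door = pairs `(β, W)` with `W ∈ InBall κ ε₀ ε₁`, `ε₀ ≥ 0`,
`ε₁ + e^κ·72√2·|β| ≤ 1/3`; core = the same with `ε₁ + τ₁ + e^κ·72√2·(|β| + τc) ≤ 1/3`. -/
def ofBasin {S : ℕ} [NeZero S] (hS : 3 ≤ S) {κ : ℝ} (hκ : 1 / 100 ≤ κ) (τc : ℝ) {τ₀ : ℝ} (hτ₀ : 0 ≤ τ₀) (τ₁ : ℝ) :
    OpenDoor S (16 * Real.exp (1 / 50)) (1 / 100) κ τc τ₀ τ₁ where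
  door := {p | ∃ ε₀ ε₁ : ℝ, 0 ≤ ε₀ ∧ InBall κ ε₀ ε₁ p.2 ∧ ε₁ + Real.exp κ * (72 * Real.sqrt 2 * |p.1|) ≤ 1 / 3}
  core := {p | ∃ ε₀ ε₁ : ℝ, 0 ≤ ε₀ ∧ InBall κ ε₀ ε₁ p.2 ∧
    ε₁ + τ₁ + Real.exp κ * (72 * Real.sqrt 2 * (|p.1| + τc)) ≤ 1 / 3}
  clusters β W hp := by
    obtain ⟨ε₀, ε₁, hε₀, hW, hsmall⟩ := hp
    exact SU2.clustersWith_of_smallWilson hκ hε₀ hS hW hsmall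
  isOpen β W hp c V hc hV := by
    obtain ⟨ε₀, ε₁, hε₀, hW, hsmall⟩ := hp
    change ε₁ + τ₁ + Real.exp κ * (72 * Real.sqrt 2 * (|β| + τc)) ≤ 1 / 3 at hsmall
    show ∃ ε₀' ε₁' : ℝ, 0 ≤ ε₀' ∧ InBall κ ε₀' ε₁' (W + V) ∧ ε₁' + Real.exp κ * (72 * Real.sqrt 2 * |β + c|) ≤ 1 / 3
    refine ⟨ε₀ + τ₀, ε₁ + τ₁, add_nonneg hε₀ hτ₀, inBall_add hW hV, ?_⟩
    have habs : |β + c| ≤ |β| + τc := (abs_add_le _ _).trans (add_le_add le_rfl hc)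
    calc ε₁ + τ₁ + Real.exp κ * (72 * Real.sqrt 2 * |β + c|)
        = ε₁ + τ₁ + Real.exp κ * (72 * Real.sqrt 2) * |β + c| := by ring
      _ ≤ ε₁ + τ₁ + Real.exp κ * (72 * Real.sqrt 2) * (|β| + τc) := by gcongr
      _ = ε₁ + τ₁ + Real.exp κ * (72 * Real.sqrt 2 * (|β| + τc)) := by ring
      _ ≤ 1 / 3 := hsmall

/-! ### The Dobrushin–Shlosman WINDOW door, typed over the tree's certificate structure (its two inputs GAP-STATED) -/

/-- **THE DS WINDOW DOOR `DSDoor S R N⋆ γ`.**  The pairs `(β, W)` whose perturbed torus specification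
`perturbedTorusSpec W β` (tree `RobustBall/Defs`) CARRIES a Dobrushin–Shlosman window certificate — tree
`Summit.Ventures.YMGap.DSWindow.Certificate` (`Thresholds/DSWindowCertificate.lean`): a window system of multiplicity
`≤ N⋆`, a cell weight bounded by `≤ R`, an influence array with the one-boundary-cell Kantorovich contraction (H1) of every
window kernel and the received-sum ratio (H2) `≤ γ < 1`.  A finite-size strong-mixing condition: finitely many finite-volume
kernels of ONE interaction — an OPEN condition at every coupling, not a smallness of `β`.  (No member is asserted: the tree
records no certificate instance beyond the single-link radius for `SU(2)`, `d = 4`.) -/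
def DSDoor (S : ℕ) [NeZero S] (R : ℝ) (Nstar : ℕ) (γ : ℝ) : Set (ℝ × Perturbation 4 S 2) :=
  {p | ∃ C : Summit.Ventures.YMGap.DSWindow.Certificate (perturbedTorusSpec p.2 p.1) (id : Edge 4 S → Edge 4 S),
    C.R ≤ R ∧ C.Nstar ≤ Nstar ∧ C.γ₀ ≤ γ}

/-- GAP-STATED (size S/M) — **a window certificate delivers clustering in the ball's currency** with constants depending on
`(R, N⋆, γ)` only.  In the tree: the covariance bound `Certificate.abs_covariance_le` for every Gibbs measure of the
specification and every adapted profile; NOT in the tree: the profile construction for a general window system (single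
link: `exists_linkProfile`) and the dictionary `ClustersWith`-observables ↦ `Certificate.Obs` for the Frobenius weight. -/
@[folklore] def DSDoorClusters (S : ℕ) [NeZero S] (R : ℝ) (Nstar : ℕ) (γ A m : ℝ) : Prop :=
  ∀ (β : ℝ) (W : Perturbation 4 S 2), (β, W) ∈ DSDoor S R Nstar γ → ClustersWith W β A m

/-- GAP-STATED (size M) — **window certificates are OPEN in load currency**: a certificate of ratio `≤ γ` survives, as a
certificate of ratio `≤ γ'` (`γ < γ' < 1`, same windows and weight), a coupling drift `≤ τc` and an added perturbation of
loads `≤ (τ₀, τ₁)` at rate `κ`, for margins depending on `(R, N⋆, γ, γ', κ)` only: the window kernels of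
`perturbedTorusSpec (W + V) (β + c)` are exponential tilts of those of `perturbedTorusSpec W β` by a window-local energy of
oscillation `O(|win|·(τ₀ + 24 e^κ τc))`, so the (H1) arrays move continuously (Dobrushin–Shlosman's «constructive
criterion»: a finite-size condition is checked on finitely many kernels, each continuous in the potential). -/
@[folklore] def DSDoorOpen (S : ℕ) [NeZero S] (R : ℝ) (Nstar : ℕ) (γ γ' κ τc τ₀ τ₁ : ℝ) : Prop :=
  ∀ (β : ℝ) (W : Perturbation 4 S 2), (β, W) ∈ DSDoor S R Nstar γ → ∀ (c : ℝ) (V : Perturbation 4 S 2), |c| ≤ τc →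
    InBall κ τ₀ τ₁ V → (β + c, W + V) ∈ DSDoor S R Nstar γ'

/-- **The window door packaged as an open door** (door = ratio `γ'`, core = ratio `γ`), GIVEN its two gap-stated inputs. -/
def ofDS {S : ℕ} [NeZero S] {R γ γ' A m κ τc τ₀ τ₁ : ℝ} {Nstar : ℕ} (hcl : DSDoorClusters S R Nstar γ' A m)
    (hop : DSDoorOpen S R Nstar γ γ' κ τc τ₀ τ₁) : OpenDoor S A m κ τc τ₀ τ₁ where
  door := DSDoor S R Nstar γ'
  core := DSDoor S R Nstar γ
  clusters := hcl
  isOpen := hop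

/-- **SANITY — the window door contains the single-link Dobrushin door** (tree `Certificate.ofKRContraction`): a pair
`(β, W)` whose perturbed specification satisfies Dobrushin's condition in the Vasserstein form (`IsKRContraction` with a
weight `r ≤ R` and row sums `≤ c < 1` — the shape every certified row of track Y2 establishes internally) is in
`DSDoor S R 1 c`. -/
theorem mem_DSDoor_of_isKRContraction {S : ℕ} [NeZero S] {β : ℝ} {W : Perturbation 4 S 2} {r : SUN 2 → SUN 2 → ℝ}
    {nbr : Edge 4 S → Finset (Edge 4 S)} {C : Edge 4 S → Edge 4 S → ℝ}
    (hC : IsKRContraction (perturbedTorusSpec W β) r nbr C) {R c : ℝ} (hR : 0 ≤ R) (hrR : ∀ a b, r a b ≤ R)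
    (hc0 : 0 ≤ c) (hc1 : c < 1) (hrow : ∀ x, ∑ y ∈ nbr x, C x y ≤ c) : (β, W) ∈ DSDoor S R 1 c :=
  ⟨Summit.Ventures.YMGap.DSWindow.Certificate.ofKRContraction (isSpecification_perturbedTorusSpec W β) hC hR hrR hc0 hc1
    hrow, le_rfl, le_rfl, le_rfl⟩

end OpenDoor

/-- ★ **COROLLARY — the `1/3` cell as an open door, reference = PURE WILSON at `β_W = 1/6`.**  If at every index `i` the exit
action is in Gibbs form with effective coupling within `1/12` (tree units) of `βr = 1/12` — i.e. anywhere in the cell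
`β_W,eff ∈ [0, 1/3]` — and with terms of loads `≤ (11/500, 11/1000)` at rate `1/100` (U-CV with these tolerances about the
reference terms `0`), then block-level IR holds at `(16 e^{1/50}, 1/100)` for EVERY `i`.  (For a cell U-CV is just
membership index by index; the content of §9 is the window-door case `OpenDoor.ofDS`.) -/
theorem blockClusters_forall_third {S : ℕ} [NeZero S] (hS : 3 ≤ S) {ι : Type*} {bOf : ι → ℕ} [∀ i, NeZero (bOf i)]
    (B : ∀ i, GaugeBlockAveraging 4 (SUN 2) (bOf i) S) (βbare : ι → ℝ) (𝓔 : ι → BalabanEffectiveAction 4 S (SUN 2) 1)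
    (hGibbs : ∀ i, IsBalabanEffectiveActionOf SU2.ρ2 (B i) (βbare i) (𝓔 i))
    (hcv : CloseInLoads 𝓔 (1 / 12) 0 (1 / 12) (1 / 100) (11 / 500) (11 / 1000)) (i : ι) :
    SU2.BlockClusters (B i) (βbare i) (16 * Real.exp (1 / 50)) (1 / 100) := by
  refine (OpenDoor.ofDoorCell doorCell_oneThird hS le_rfl (1 / 12) (11 / 500) (11 / 1000)).blockClusters_forall B βbare 𝓔
    hGibbs ?_ hcv i
  show (1 / 12 : ℝ) ≤ 1 / 12 ∧ (1 / 12 : ℝ) ≤ 1 / 6 - 1 / 12 ∧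
    InBall (1 / 100) (11 / 500 - 11 / 500) (11 / 1000 - 11 / 1000) (0 : Perturbation 4 S 2)
  exact ⟨le_rfl, by norm_num, zero_mem_clusterDomain (by norm_num) (by norm_num)⟩

/-- ★ **COROLLARY — U-CV in Bałaban's currency against the `1/3` cell.**  Exit actions whose effective couplings lie in
`[0, 1/6]` (tree) and whose terms are in strip format `(r, κ, τ)` with thin supports, `κ ≥ 1/100 + δ`, `2τ ≤ 11/500`,
`8τ/(eδr) ≤ 11/1000` ⇒ block-level IR for every index. -/
theorem blockClusters_forall_third_strip {S : ℕ} [NeZero S] (hS : 3 ≤ S) {ι : Type*} {bOf : ι → ℕ}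
    [∀ i, NeZero (bOf i)] (B : ∀ i, GaugeBlockAveraging 4 (SUN 2) (bOf i) S) (βbare : ι → ℝ)
    (𝓔 : ι → BalabanEffectiveAction 4 S (SUN 2) 1) (hGibbs : ∀ i, IsBalabanEffectiveActionOf SU2.ρ2 (B i) (βbare i) (𝓔 i))
    {r κ τ δ : ℝ} (hr : 0 < r) (hδ : 0 < δ) (hκ : 1 / 100 + δ ≤ κ) (hcv : CloseInStrip 𝓔 (1 / 12) 0 (1 / 12) r κ τ)
    (h₀ : 2 * τ ≤ 11 / 500) (h₁ : 8 / (Real.exp 1 * δ * r) * τ ≤ 11 / 1000) (i : ι) :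
    SU2.BlockClusters (B i) (βbare i) (16 * Real.exp (1 / 50)) (1 / 100) := by
  have hL := closeInLoads_of_closeInStrip hcv hr (by norm_num : (0:ℝ) ≤ 1 / 100) hδ hκ
  refine (OpenDoor.ofDoorCell doorCell_oneThird hS le_rfl (1 / 12) (2 * τ)
    (8 / (Real.exp 1 * δ * r) * τ)).blockClusters_forall B βbare 𝓔 hGibbs ?_ hL i
  show (1 / 12 : ℝ) ≤ 1 / 12 ∧ (1 / 12 : ℝ) ≤ 1 / 6 - 1 / 12 ∧
    InBall (1 / 100) (11 / 500 - 2 * τ) (11 / 1000 - 8 / (Real.exp 1 * δ * r) * τ) (0 : Perturbation 4 S 2)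
  exact ⟨le_rfl, by norm_num, zero_mem_clusterDomain (by linarith) (by linarith)⟩



end Summit.Ventures.YMGap.YM4Door

end
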